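import Summits.NavierStokesRegularity.NavierStokesRegularity.Theorems.EfficiencyFloorNearSaturationNearMaximiserSeqCoreSplitting
import HarnessLib

/-!
# Route `EfficiencyFloor`, crux `NearSaturationNearMaximiser` (stmt-NavierStokesRegularity-25482) on the
# `ProductionEfficiencyDecay` ladder (stmt-22866): WEAK PAIRINGS — the density upgrade and the `Lᵖ` bookkeeping

Def-free helper file, fifth of the group `…SeqCoreUpgrade` / `…SeqCoreCentring` / `…SeqCorePythagoras` /
`…SeqCoreSplitting`. The remaining hypothesis (P_w') of `nearSaturationNearMaximiser_of_centredLocalWeakLimitMixed` asks, along a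
subsequence `v_{φ k}` and for an admissible `w`, for (b) the weak pairings `∫⟪curl v_{φk}, curl w⟫ → Z(w)`,
`∫Σᵢ⟪D curl v_{φk} eᵢ, D curl w eᵢ⟫ → Pal(w)` and (c'-lin) the three mixed trilinear stretching terms that are LINEAR in
`r_k = v_{φk} − w` to tend to zero. Both follow from the weak (distributional) convergence `r_k ⇀ 0` at the level of
`curl r_k`, `∂ⱼ r_k`, `∂ⱼ curl r_k` tested against continuous compactly supported fields, by DENSITY of `C_c` in `L^{q}` and the
uniform `L²`/`L⁴` bounds along the sequence. This file supplies the two general tools: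

* `integrable_inner_of_memLp` — `⟪f, g⟫` is integrable for `f ∈ Lᵖ`, `g ∈ L^{q}`, `p⁻¹ + q⁻¹ = 1`;
* `tendsto_integral_inner_of_testFields` — **the density upgrade**: if `∫‖f_k‖ᵖ ≤ C` and `∫⟪f_k, ψ⟫ → 0` for every continuous
  compactly supported `ψ ∈ L^{q}`, then `∫⟪f_k, G⟫ → 0` for every `G ∈ L^{q}` (Hölder + `MemLp.exists_hasCompactSupport_integral_rpow_sub_le`);

and the `Lᵖ` membership facts of admissible fields used to instantiate it (`curl v ∈ L² ∩ L⁴`, `∂ⱼv, ∂ⱼ curl v ∈ L²`,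
`Dw(curl w), (Dw)†(curl w) ∈ L^{4/3}`, `(curl w)ⱼ • curl w ∈ L²`).

HONEST FRAMING: bookkeeping only; stmt-25482, `LerayFloorGap`, `ProductionEfficiencyDecay` (stmt-22866) and Navier–Stokes regularity
stay OPEN; no summit statement is proved. [folklore]
-/

-- the problem directory repeats the summit name (`NavierStokesRegularity/NavierStokesRegularity`)
set_option linter.dupNamespace false

noncomputable section

namespace Summit.NavierStokesRegularity.NavierStokesRegularity.Theorems

namespace NearSaturationNearMaximiser

namespace SeqCore

open Set MeasureTheory Filter Topology Function
open scoped InnerProductSpace ENNReal NNReal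
open Literature.Analysis.FluidPDE
open Magsanop2026Enstrophy (slice_integrable)

/-! ## §1 Pairings of `Lᵖ` and `L^{q}` fields -/

/-- `⟪f, g⟫` is integrable for `f ∈ Lᵖ`, `g ∈ L^{q}` with `p⁻¹ + q⁻¹ = 1` (Hölder). [folklore] -/
theorem integrable_inner_of_memLp {p q : ℝ} (hpq : p.HolderConjugate q)
    {F : Type*} [NormedAddCommGroup F] [InnerProductSpace ℝ F]
    {f g : EuclideanSpace ℝ (Fin 3) → F}
    (hf : MemLp f (ENNReal.ofReal p) volume) (hg : MemLp g (ENNReal.ofReal q) volume) :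
    Integrable (fun x => ⟪f x, g x⟫_ℝ) := by
  haveI := hpq.ennrealOfReal
  have h : Integrable ((fun x => ‖f x‖) * fun x => ‖g x‖) := hf.norm.integrable_mul hg.norm
  refine h.mono' (hf.1.inner hg.1) (ae_of_all _ fun x => ?_)
  rw [Real.norm_eq_abs]
  exact abs_real_inner_le_norm (f x) (g x)

/-- `∫ ‖f‖·‖g‖` is finite (the product of norms is integrable) for `f ∈ Lᵖ`, `g ∈ L^{q}`, `p⁻¹ + q⁻¹ = 1`. [folklore] -/
theorem integrable_norm_mul_norm_of_memLp {p q : ℝ} (hpq : p.HolderConjugate q)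
    {F : Type*} [NormedAddCommGroup F]
    {f g : EuclideanSpace ℝ (Fin 3) → F}
    (hf : MemLp f (ENNReal.ofReal p) volume) (hg : MemLp g (ENNReal.ofReal q) volume) :
    Integrable (fun x => ‖f x‖ * ‖g x‖) := by
  haveI := hpq.ennrealOfReal
  exact hf.norm.integrable_mul hg.norm

/-- **The density upgrade of weak convergence.** Let `p⁻¹ + q⁻¹ = 1`. If `f_k ∈ Lᵖ` with `∫‖f_k‖ᵖ ≤ C` for all `k`, and
`∫⟪f_k, ψ⟫ → 0` for every continuous compactly supported `ψ ∈ L^{q}`, then `∫⟪f_k, G⟫ → 0` for every `G ∈ L^{q}`: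
approximate `G` by such a `ψ` in `L^{q}` (`MemLp.exists_hasCompactSupport_integral_rpow_sub_le`) and bound the remainder by
Hölder, `|∫⟪f_k, G − ψ⟫| ≤ C^{1/p}‖G − ψ‖_{q}` uniformly in `k`. [folklore] -/
theorem tendsto_integral_inner_of_testFields {p q : ℝ} (hpq : p.HolderConjugate q)
    {F : Type*} [NormedAddCommGroup F] [InnerProductSpace ℝ F]
    {f : ℕ → EuclideanSpace ℝ (Fin 3) → F} {C : ℝ}
    (hf : ∀ k, MemLp (f k) (ENNReal.ofReal p) volume)
    (hC : ∀ k, ∫ x, ‖f k x‖ ^ p ≤ C)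
    (htest : ∀ ψ : EuclideanSpace ℝ (Fin 3) → F, Continuous ψ → HasCompactSupport ψ →
      MemLp ψ (ENNReal.ofReal q) volume → Tendsto (fun k => ∫ x, ⟪f k x, ψ x⟫_ℝ) atTop (𝓝 0))
    {G : EuclideanSpace ℝ (Fin 3) → F} (hG : MemLp G (ENNReal.ofReal q) volume) :
    Tendsto (fun k => ∫ x, ⟪f k x, G x⟫_ℝ) atTop (𝓝 0) := by
  rw [Metric.tendsto_atTop]
  intro ε hε
  have hp0 : 0 < p := hpq.pos
  have hq0 : 0 < q := hpq.symm.pos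
  have hC0 : 0 ≤ C := le_trans (integral_nonneg fun x => Real.rpow_nonneg (norm_nonneg _) _) (hC 0)
  set B : ℝ := C ^ (1 / p) with hB
  have hB0 : 0 ≤ B := Real.rpow_nonneg hC0 _
  set δ : ℝ := ε / (2 * (B + 1)) with hδ
  have hδ0 : 0 < δ := by positivity
  -- approximate `G` in `L^q` by a continuous compactly supported field
  obtain ⟨ψ, hψc, hψε, hψcont, hψmem⟩ :=
    hG.exists_hasCompactSupport_integral_rpow_sub_le hq0 (Real.rpow_pos_of_pos hδ0 q)
  have hev := htest ψ hψcont hψc hψmem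
  rw [Metric.tendsto_atTop] at hev
  obtain ⟨N, hN⟩ := hev (ε / 2) (half_pos hε)
  refine ⟨N, fun k hk => ?_⟩
  have hk' := hN k hk
  rw [Real.dist_0_eq_abs] at hk' ⊢
  have hGψ : MemLp (fun x => G x - ψ x) (ENNReal.ofReal q) volume := hG.sub hψmem
  have I1 : Integrable (fun x => ⟪f k x, ψ x⟫_ℝ) := integrable_inner_of_memLp hpq (hf k) hψmem
  have I2 : Integrable (fun x => ⟪f k x, G x - ψ x⟫_ℝ) := integrable_inner_of_memLp hpq (hf k) hGψ
  have hsplit : (∫ x, ⟪f k x, G x⟫_ℝ) = (∫ x, ⟪f k x, ψ x⟫_ℝ) + ∫ x, ⟪f k x, G x - ψ x⟫_ℝ := by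
    rw [← integral_add I1 I2]
    refine integral_congr_ae (ae_of_all _ fun x => ?_)
    show ⟪f k x, G x⟫_ℝ = ⟪f k x, ψ x⟫_ℝ + ⟪f k x, G x - ψ x⟫_ℝ
    rw [← inner_add_right, add_sub_cancel]
  -- Hölder on the remainder
  have hH : |∫ x, ⟪f k x, G x - ψ x⟫_ℝ| ≤ B * δ := by
    calc |∫ x, ⟪f k x, G x - ψ x⟫_ℝ| ≤ ∫ x, |⟪f k x, G x - ψ x⟫_ℝ| := abs_integral_le_integral_abs
      _ ≤ ∫ x, ‖f k x‖ * ‖G x - ψ x‖ :=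
          integral_mono_of_nonneg (ae_of_all _ fun x => abs_nonneg _)
            (integrable_norm_mul_norm_of_memLp hpq (hf k) hGψ) (ae_of_all _ fun x => abs_real_inner_le_norm _ _)
      _ ≤ (∫ x, ‖f k x‖ ^ p) ^ (1 / p) * (∫ x, ‖G x - ψ x‖ ^ q) ^ (1 / q) :=
          integral_mul_norm_le_Lp_mul_Lq hpq (hf k) hGψ
      _ ≤ B * δ := by
          refine mul_le_mul ?_ ?_ (Real.rpow_nonneg (integral_nonneg fun x => Real.rpow_nonneg (norm_nonneg _) _) _) hB0
          · exact Real.rpow_le_rpow (integral_nonneg fun x => Real.rpow_nonneg (norm_nonneg _) _) (hC k)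
              (by positivity)
          · calc (∫ x, ‖G x - ψ x‖ ^ q) ^ (1 / q) ≤ (δ ^ q) ^ (1 / q) :=
                  Real.rpow_le_rpow (integral_nonneg fun x => Real.rpow_nonneg (norm_nonneg _) _) hψε (by positivity)
              _ = δ := by rw [one_div, Real.rpow_rpow_inv hδ0.le hq0.ne']
  have hBδ : B * δ < ε / 2 := by
    have h1 : B / (B + 1) < 1 := (div_lt_one (by positivity)).2 (lt_add_one B)
    calc B * δ = (ε / 2) * (B / (B + 1)) := by rw [hδ]; field_simp
      _ < (ε / 2) * 1 := by gcongr
      _ = ε / 2 := mul_one _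
  rw [hsplit]
  calc |(∫ x, ⟪f k x, ψ x⟫_ℝ) + ∫ x, ⟪f k x, G x - ψ x⟫_ℝ|
      ≤ |∫ x, ⟪f k x, ψ x⟫_ℝ| + |∫ x, ⟪f k x, G x - ψ x⟫_ℝ| := abs_add_le _ _
    _ < ε / 2 + ε / 2 := add_lt_add hk' (hH.trans_lt hBδ)
    _ = ε := add_halves ε

/-! ## §2 `Lᵖ` membership of the fields built from an admissible field -/

/-- A continuous field with `∫‖f‖ⁿ < ∞` (`n ≥ 1` a natural number) lies in `L^{n}` (`MemLp f (ofReal n)`). [folklore] -/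
theorem memLp_ofReal_nat_of_integrable_pow {F : Type*} [NormedAddCommGroup F] {f : EuclideanSpace ℝ (Fin 3) → F}
    (hf : AEStronglyMeasurable f volume) {n : ℕ} (hn : n ≠ 0) (hI : Integrable (fun x => ‖f x‖ ^ n)) :
    MemLp f (ENNReal.ofReal n) volume := by
  have h0 : ENNReal.ofReal (n : ℝ) ≠ 0 := by
    rw [Ne, ENNReal.ofReal_eq_zero, not_le]
    exact_mod_cast Nat.pos_of_ne_zero hn
  rw [← integrable_norm_rpow_iff hf h0 ENNReal.ofReal_ne_top]
  refine hI.congr (ae_of_all _ fun x => ?_)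
  simp only [ENNReal.toReal_ofReal (Nat.cast_nonneg n), Real.rpow_natCast]

/-- `∫‖f‖^{(n : ℝ)} = ∫‖f‖ⁿ` (real power with natural exponent). [folklore] -/
theorem integral_norm_rpow_natCast {F : Type*} [NormedAddCommGroup F] (f : EuclideanSpace ℝ (Fin 3) → F) (n : ℕ) :
    ∫ x, ‖f x‖ ^ (n : ℝ) = ∫ x, ‖f x‖ ^ n :=
  integral_congr_ae (ae_of_all _ fun _ => Real.rpow_natCast _ _)

/-- The vorticity of an admissible field lies in `L²`: `MemLp (curl v) (ofReal 2)`. [folklore] -/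
theorem memLp_two_curl {v : EuclideanSpace ℝ (Fin 3) → EuclideanSpace ℝ (Fin 3)} (hv : ContDiff ℝ (⊤ : ℕ∞) v)
    (h1 : ∫⁻ x, ‖iteratedFDeriv ℝ 1 v x‖ₑ ^ 2 < ⊤) :
    MemLp (curl v) (ENNReal.ofReal (2 : ℕ)) volume := by
  have hωc : Continuous (curl v) := (contDiff_curl (n := 1) (hv.of_le (by norm_cast))).continuous
  exact memLp_ofReal_nat_of_integrable_pow hωc.aestronglyMeasurable two_ne_zero
    (integrable_norm_curl_sq (hv.of_le (by norm_cast)) h1).1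

/-- The vorticity of an admissible field lies in `L⁴` (Ladyzhenskaya): `MemLp (curl v) (ofReal 4)`. [folklore] -/
theorem memLp_four_curl {v : EuclideanSpace ℝ (Fin 3) → EuclideanSpace ℝ (Fin 3)} (hv : ContDiff ℝ (⊤ : ℕ∞) v)
    (h1 : ∫⁻ x, ‖iteratedFDeriv ℝ 1 v x‖ₑ ^ 2 < ⊤) (h2 : ∫⁻ x, ‖iteratedFDeriv ℝ 2 v x‖ₑ ^ 2 < ⊤) :
    MemLp (curl v) (ENNReal.ofReal (4 : ℕ)) volume := by
  have hωc : Continuous (curl v) := (contDiff_curl (n := 1) (hv.of_le (by norm_cast))).continuous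
  exact memLp_ofReal_nat_of_integrable_pow hωc.aestronglyMeasurable (by norm_num) (stretch_integrable hv h1 h2).1

/-- A partial derivative `∂ₑv = Dv(·) e` (`‖e‖ ≤ 1`) of an admissible field lies in `L²`, with `∫‖∂ₑv‖² ≤ ∫‖Dv‖²`. [folklore] -/
theorem memLp_two_fderiv_apply {v : EuclideanSpace ℝ (Fin 3) → EuclideanSpace ℝ (Fin 3)} (hv : ContDiff ℝ (⊤ : ℕ∞) v)
    (h1 : ∫⁻ x, ‖iteratedFDeriv ℝ 1 v x‖ₑ ^ 2 < ⊤) (h2 : ∫⁻ x, ‖iteratedFDeriv ℝ 2 v x‖ₑ ^ 2 < ⊤)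
    {e : EuclideanSpace ℝ (Fin 3)} (he : ‖e‖ ≤ 1) :
    Integrable (fun x => ‖fderiv ℝ v x e‖ ^ 2) ∧ (∫ x, ‖fderiv ℝ v x e‖ ^ 2 ≤ ∫ x, ‖fderiv ℝ v x‖ ^ 2) ∧
      MemLp (fun x => fderiv ℝ v x e) (ENNReal.ofReal (2 : ℕ)) volume := by
  obtain ⟨-, IDv, -⟩ := stretch_integrable hv h1 h2
  have hDc : Continuous (fderiv ℝ v) := (hv.of_le (by norm_cast) : ContDiff ℝ 1 v).continuous_fderiv one_ne_zero
  have hc : Continuous (fun x => fderiv ℝ v x e) := hDc.clm_apply continuous_const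
  have hpt : ∀ x, ‖fderiv ℝ v x e‖ ^ 2 ≤ ‖fderiv ℝ v x‖ ^ 2 := fun x => by
    refine pow_le_pow_left₀ (norm_nonneg _) ?_ 2
    calc ‖fderiv ℝ v x e‖ ≤ ‖fderiv ℝ v x‖ * ‖e‖ := (fderiv ℝ v x).le_opNorm e
      _ ≤ ‖fderiv ℝ v x‖ * 1 := by gcongr
      _ = ‖fderiv ℝ v x‖ := mul_one _
  have hI : Integrable (fun x => ‖fderiv ℝ v x e‖ ^ 2) :=
    IDv.mono' (hc.norm.pow 2).aestronglyMeasurable (ae_of_all _ fun x => by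
      rw [Real.norm_eq_abs, abs_of_nonneg (sq_nonneg _)]; exact hpt x)
  exact ⟨hI, integral_mono hI IDv hpt, memLp_ofReal_nat_of_integrable_pow hc.aestronglyMeasurable two_ne_zero hI⟩

/-- `‖A e‖² ≤ |A|²_F` for a vector `e` of the standard orthonormal basis `EuclideanSpace.basisFun`. [folklore] -/
theorem norm_apply_basisFun_sq_le_frobeniusNormSq (A : EuclideanSpace ℝ (Fin 3) →L[ℝ] EuclideanSpace ℝ (Fin 3)) (j : Fin 3) :
    ‖A (EuclideanSpace.basisFun (Fin 3) ℝ j)‖ ^ 2 ≤ frobeniusNormSq A := by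
  rw [frobeniusNormSq_eq_sum (EuclideanSpace.basisFun (Fin 3) ℝ)]
  exact Finset.single_le_sum (f := fun i => ‖A (EuclideanSpace.basisFun (Fin 3) ℝ i)‖ ^ 2)
    (fun i _ => sq_nonneg _) (Finset.mem_univ j)

/-- A partial derivative `∂ⱼ curl v` of the vorticity of an admissible field lies in `L²`, with
`∫‖∂ⱼ curl v‖² ≤ Pal(v)`. [folklore] -/
theorem memLp_two_fderiv_curl_apply {v : EuclideanSpace ℝ (Fin 3) → EuclideanSpace ℝ (Fin 3)} (hv : ContDiff ℝ (⊤ : ℕ∞) v)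
    (h1 : ∫⁻ x, ‖iteratedFDeriv ℝ 1 v x‖ₑ ^ 2 < ⊤) (h2 : ∫⁻ x, ‖iteratedFDeriv ℝ 2 v x‖ₑ ^ 2 < ⊤) (j : Fin 3) :
    Integrable (fun x => ‖fderiv ℝ (curl v) x (EuclideanSpace.basisFun (Fin 3) ℝ j)‖ ^ 2) ∧
      (∫ x, ‖fderiv ℝ (curl v) x (EuclideanSpace.basisFun (Fin 3) ℝ j)‖ ^ 2 ≤ ∫ x, frobeniusNormSq (fderiv ℝ (curl v) x)) ∧
      MemLp (fun x => fderiv ℝ (curl v) x (EuclideanSpace.basisFun (Fin 3) ℝ j)) (ENNReal.ofReal (2 : ℕ)) volume := by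
  have hv3 : ContDiff ℝ 3 v := hv.of_le (by norm_cast)
  obtain ⟨-, -, IF, -⟩ := slice_integrable hv3 h1 h2
  have hω1 : ContDiff ℝ 1 (curl v) := contDiff_curl (n := 1) (hv.of_le (by norm_cast))
  have hDc : Continuous (fderiv ℝ (curl v)) := hω1.continuous_fderiv one_ne_zero
  have hc : Continuous (fun x => fderiv ℝ (curl v) x (EuclideanSpace.basisFun (Fin 3) ℝ j)) :=
    hDc.clm_apply continuous_const
  have hpt : ∀ x, ‖fderiv ℝ (curl v) x (EuclideanSpace.basisFun (Fin 3) ℝ j)‖ ^ 2 ≤ frobeniusNormSq (fderiv ℝ (curl v) x) :=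
    fun x => norm_apply_basisFun_sq_le_frobeniusNormSq _ j
  have hI : Integrable (fun x => ‖fderiv ℝ (curl v) x (EuclideanSpace.basisFun (Fin 3) ℝ j)‖ ^ 2) :=
    IF.mono' (hc.norm.pow 2).aestronglyMeasurable (ae_of_all _ fun x => by
      rw [Real.norm_eq_abs, abs_of_nonneg (sq_nonneg _)]; exact hpt x)
  exact ⟨hI, integral_mono hI IF hpt, memLp_ofReal_nat_of_integrable_pow hc.aestronglyMeasurable two_ne_zero hI⟩

/-- `2, 4, 4/3` is a Hölder triple: `L² · L⁴ ⊂ L^{4/3}`. [folklore] -/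
theorem holderTriple_two_four : ENNReal.HolderTriple (ENNReal.ofReal (2 : ℕ)) (ENNReal.ofReal (4 : ℕ)) (ENNReal.ofReal (4 / 3)) := by
  have h : Real.HolderTriple ((2 : ℕ) : ℝ) ((4 : ℕ) : ℝ) (4 / 3) := ⟨by norm_num, by norm_num, by norm_num⟩
  exact h.ennrealOfReal

/-- `4` and `4/3` are Hölder conjugate. [folklore] -/
theorem holderConjugate_four : Real.HolderConjugate ((4 : ℕ) : ℝ) (4 / 3) := by
  rw [Real.holderConjugate_iff]; norm_num

/-- `2` and `2` are Hölder conjugate (with the exponent written as a natural-number cast). [folklore] -/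
theorem holderConjugate_two : Real.HolderConjugate ((2 : ℕ) : ℝ) ((2 : ℕ) : ℝ) := by
  rw [Real.holderConjugate_iff]; norm_num

/-- For an admissible `w`: the fixed field `x ↦ Dw(x)(curl w x)` lies in `L^{4/3}` (`‖Dw‖ ∈ L²`, `‖curl w‖ ∈ L⁴`). [folklore] -/
theorem memLp_fderiv_apply_curl {w : EuclideanSpace ℝ (Fin 3) → EuclideanSpace ℝ (Fin 3)} (hw : ContDiff ℝ (⊤ : ℕ∞) w)
    (h1 : ∫⁻ x, ‖iteratedFDeriv ℝ 1 w x‖ₑ ^ 2 < ⊤) (h2 : ∫⁻ x, ‖iteratedFDeriv ℝ 2 w x‖ₑ ^ 2 < ⊤) :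
    MemLp (fun x => fderiv ℝ w x (curl w x)) (ENNReal.ofReal (4 / 3)) volume := by
  obtain ⟨I4, IDw, -⟩ := stretch_integrable hw h1 h2
  have hθc : Continuous (curl w) := (contDiff_curl (n := 1) (hw.of_le (by norm_cast))).continuous
  have hDc : Continuous (fderiv ℝ w) := (hw.of_le (by norm_cast) : ContDiff ℝ 1 w).continuous_fderiv one_ne_zero
  have mD : MemLp (fun x => ‖fderiv ℝ w x‖) (ENNReal.ofReal (2 : ℕ)) volume :=
    (memLp_ofReal_nat_of_integrable_pow hDc.aestronglyMeasurable two_ne_zero IDw).norm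
  have mθ : MemLp (fun x => ‖curl w x‖) (ENNReal.ofReal (4 : ℕ)) volume :=
    (memLp_ofReal_nat_of_integrable_pow hθc.aestronglyMeasurable (by norm_num) I4).norm
  haveI := holderTriple_two_four
  have mprod : MemLp (fun x => ‖fderiv ℝ w x‖ * ‖curl w x‖) (ENNReal.ofReal (4 / 3)) volume := mθ.mul' mD
  refine mprod.of_le (hDc.clm_apply hθc).aestronglyMeasurable (ae_of_all _ fun x => ?_)
  rw [Real.norm_eq_abs, abs_of_nonneg (mul_nonneg (norm_nonneg _) (norm_nonneg _))]
  exact (fderiv ℝ w x).le_opNorm _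

/-- For an admissible `w`: the fixed field `x ↦ (Dw(x))†(curl w x)` lies in `L^{4/3}`. [folklore] -/
theorem memLp_adjoint_fderiv_apply_curl {w : EuclideanSpace ℝ (Fin 3) → EuclideanSpace ℝ (Fin 3)} (hw : ContDiff ℝ (⊤ : ℕ∞) w)
    (h1 : ∫⁻ x, ‖iteratedFDeriv ℝ 1 w x‖ₑ ^ 2 < ⊤) (h2 : ∫⁻ x, ‖iteratedFDeriv ℝ 2 w x‖ₑ ^ 2 < ⊤) :
    MemLp (fun x => ContinuousLinearMap.adjoint (fderiv ℝ w x) (curl w x)) (ENNReal.ofReal (4 / 3)) volume := by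
  obtain ⟨I4, IDw, -⟩ := stretch_integrable hw h1 h2
  have hθc : Continuous (curl w) := (contDiff_curl (n := 1) (hw.of_le (by norm_cast))).continuous
  have hDc : Continuous (fderiv ℝ w) := (hw.of_le (by norm_cast) : ContDiff ℝ 1 w).continuous_fderiv one_ne_zero
  have hAc : Continuous (fun x => ContinuousLinearMap.adjoint (fderiv ℝ w x)) :=
    (ContinuousLinearMap.adjoint :
      (EuclideanSpace ℝ (Fin 3) →L[ℝ] EuclideanSpace ℝ (Fin 3)) ≃ₗᵢ⋆[ℝ]
        (EuclideanSpace ℝ (Fin 3) →L[ℝ] EuclideanSpace ℝ (Fin 3))).continuous.comp hDc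
  have mD : MemLp (fun x => ‖fderiv ℝ w x‖) (ENNReal.ofReal (2 : ℕ)) volume :=
    (memLp_ofReal_nat_of_integrable_pow hDc.aestronglyMeasurable two_ne_zero IDw).norm
  have mθ : MemLp (fun x => ‖curl w x‖) (ENNReal.ofReal (4 : ℕ)) volume :=
    (memLp_ofReal_nat_of_integrable_pow hθc.aestronglyMeasurable (by norm_num) I4).norm
  haveI := holderTriple_two_four
  have mprod : MemLp (fun x => ‖fderiv ℝ w x‖ * ‖curl w x‖) (ENNReal.ofReal (4 / 3)) volume := mθ.mul' mD
  refine mprod.of_le (hAc.clm_apply hθc).aestronglyMeasurable (ae_of_all _ fun x => ?_)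
  rw [Real.norm_eq_abs, abs_of_nonneg (mul_nonneg (norm_nonneg _) (norm_nonneg _))]
  calc ‖ContinuousLinearMap.adjoint (fderiv ℝ w x) (curl w x)‖
      ≤ ‖ContinuousLinearMap.adjoint (fderiv ℝ w x)‖ * ‖curl w x‖ := ContinuousLinearMap.le_opNorm _ _
    _ = ‖fderiv ℝ w x‖ * ‖curl w x‖ := by rw [LinearIsometryEquiv.norm_map]

/-- For an admissible `w` and a coordinate `j`: the fixed field `x ↦ (curl w x)ⱼ • curl w x` lies in `L²` (`‖curl w‖⁴ ∈ L¹`). [folklore] -/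
theorem memLp_coord_smul_curl {w : EuclideanSpace ℝ (Fin 3) → EuclideanSpace ℝ (Fin 3)} (hw : ContDiff ℝ (⊤ : ℕ∞) w)
    (h1 : ∫⁻ x, ‖iteratedFDeriv ℝ 1 w x‖ₑ ^ 2 < ⊤) (h2 : ∫⁻ x, ‖iteratedFDeriv ℝ 2 w x‖ₑ ^ 2 < ⊤) (j : Fin 3) :
    MemLp (fun x => (curl w x) j • curl w x) (ENNReal.ofReal (2 : ℕ)) volume := by
  obtain ⟨I4, -, -⟩ := stretch_integrable hw h1 h2
  have hθc : Continuous (curl w) := (contDiff_curl (n := 1) (hw.of_le (by norm_cast))).continuous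
  have hsq : Continuous (fun x => ‖curl w x‖ ^ 2) := hθc.norm.pow 2
  have I4' : Integrable (fun x => ‖‖curl w x‖ ^ 2‖ ^ 2) := I4.congr (ae_of_all _ fun x => by
    show ‖curl w x‖ ^ 4 = ‖‖curl w x‖ ^ 2‖ ^ 2
    rw [Real.norm_of_nonneg (sq_nonneg ‖curl w x‖)]; ring)
  have m2 : MemLp (fun x => ‖curl w x‖ ^ 2) (ENNReal.ofReal (2 : ℕ)) volume :=
    memLp_ofReal_nat_of_integrable_pow hsq.aestronglyMeasurable two_ne_zero I4'
  have hjc : Continuous (fun x => (curl w x) j) := (PiLp.continuous_apply 2 (fun _ : Fin 3 => ℝ) j).comp hθc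
  refine m2.of_le (hjc.smul hθc).aestronglyMeasurable (ae_of_all _ fun x => ?_)
  have e : ‖‖curl w x‖ ^ 2‖ = ‖curl w x‖ * ‖curl w x‖ := by
    rw [Real.norm_of_nonneg (sq_nonneg ‖curl w x‖), sq]
  rw [e, norm_smul]
  exact mul_le_mul_of_nonneg_right (by simpa using PiLp.norm_apply_le (curl w x) j) (norm_nonneg _)

end SeqCore

end NearSaturationNearMaximiser

end Summit.NavierStokesRegularity.NavierStokesRegularity.Theorems

end
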